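import Summits.Ventures.HodgeRepro2.T5SU11KernelUniformBounds
import Summits.Ventures.HodgeRepro2.T5SU11ResolventIterateKernel
import Summits.Ventures.HodgeRepro2.T5SU11RadialGreenSymmetric

/-!
# The composed kernels are jointly continuous on `(0, ∞)²`

The kernel `K_λ(t, s) = −φ_λ(min(t, s)) χ_λ(max(t, s))` is continuous on `(0, ∞)²` (row 4xx). The composed kernels are
`K_λ^{∘(n+2)}(t, s) = ∫ K_λ(t, r) K_λ^{∘(n+1)}(r, s) sinh 2r dr` (row 585, Chapman–Kolmogorov with `m = 0`); on a box
`[a, b]²` the integrand is dominated by `M (1_{(0,b]}(r) + χ_λ(r)) · C Ξ(r) sinh 2r` (the kernel bound `|K_λ(t, r)| ≤ Φ_b χ_λ(max(t, r))`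
for `t ≤ b`, row 602's uniform bound `|K_λ^{∘(n+1)}(r, s)| ≤ C Ξ(r)` for `s ≥ a`), which is integrable (row 496 on the class
source `Ξ`), so dominated convergence and induction on `n` give:

* `continuousOn_sphGreenKernel_prod` — the kernel is continuous on `(0, ∞)²`;
* `exists_abs_kernel_le_indicator_add` — the dominating bound of the kernel for `t ∈ [a, b]`;
* `continuousOn_kernel_comp_prod` — **every composed kernel `(t, s) ↦ K_λ^{∘(n+1)}(t, s)` is continuous on `(0, ∞)²`**.

Nothing is claimed about (N).

Blind lane: Mathlib + the HodgeRepro2 prefix only; no sorry; axioms ⊆ {propext, Classical.choice,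
Quot.sound}.
-/

namespace Summit.Ventures.HodgeRepro2.T5SU11KernelCompositionContinuous

open Filter Topology MeasureTheory
open Set (Ioi Ioc Icc)
open T5SU11Cartan T5SU11SphericalFunction T5SU11SphericalBounds T5SU11SphericalContinuous T5SU11SphericalDecay
  T5SU11SphericalSolutionSpaceAll T5SU11RadialGreenKernel T5SU11RadialGreenImproper T5SU11RadialGreenImproperDecaySource
  T5SU11RadialGreenSymmetric T5SU11ResolventGroundStateWeight T5SU11WeightedSpaceGroundState
  T5SU11KernelDifferenceRegularity T5SU11KernelDerivative T5SU11KernelUniformBounds T5SU11KernelTwoSidedBound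
  T5SU11ResolventIterateKernel T5SU11ResolventWeightedBasis T5SU11ResolventKernelComposition

section measure

variable [MeasurableSpace Circle] [BorelSpace Circle]

variable {lam : ℝ} (hlam : 1 < lam)

include hlam in
/-- **The kernel is continuous on `(0, ∞)²`.** -/
theorem continuousOn_sphGreenKernel_prod :
    ContinuousOn (fun p : ℝ × ℝ => sphGreenKernel lam p.1 p.2) (Ioi 0 ×ˢ Ioi 0) :=
  continuousOn_greenKernel (hφ_sph lam) (fun _ ht => hasDerivAt_sphDecay hlam ht)

include hlam in
/-- **The dominating bound of the kernel on a strip**: for `0 < a ≤ b` there is `M ≥ 0` with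
`|K_λ(t, r)| ≤ M (1_{(0,b]}(r) + χ_λ(r))` for all `t ∈ [a, b]` and `r > 0`. -/
theorem exists_abs_kernel_le_indicator_add {a b : ℝ} (ha : 0 < a) (hab : a ≤ b) :
    ∃ M : ℝ, 0 ≤ M ∧ ∀ t ∈ Icc a b, ∀ r, 0 < r →
      |sphGreenKernel lam t r| ≤ M * (Set.indicator (Ioc 0 b) (fun _ => (1 : ℝ)) r + sphDecay lam r) := by
  -- `φ_λ ≤ Φ` on `[0, b]`, `χ_λ ≤ Mχ` on `[a, b]`
  obtain ⟨Φ, _, hΦ⟩ := exists_sph_hyp_le_exp hlam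
  set Φb : ℝ := Φ * Real.exp (|lam - 2| * b) with hΦb
  have hΦb0 : 0 ≤ Φb := by positivity
  have hφle : ∀ u, 0 ≤ u → u ≤ b → sph lam (hyp u) ≤ Φb := by
    intro u hu0 hub
    calc sph lam (hyp u) ≤ Φ * Real.exp ((lam - 2) * u) := hΦ u hu0
      _ ≤ Φ * Real.exp (|lam - 2| * b) := by
          apply mul_le_mul_of_nonneg_left _ (by linarith)
          apply Real.exp_le_exp.mpr
          calc (lam - 2) * u ≤ |lam - 2| * u := mul_le_mul_of_nonneg_right (le_abs_self _) hu0
            _ ≤ |lam - 2| * b := mul_le_mul_of_nonneg_left hub (abs_nonneg _)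
  have hsub : Icc a b ⊆ Ioi 0 := fun u hu => lt_of_lt_of_le ha hu.1
  obtain ⟨u₁, _, hmax⟩ := isCompact_Icc.exists_isMaxOn (Set.nonempty_Icc.mpr hab)
    ((continuousOn_sphDecay hlam).mono hsub)
  set Mχ : ℝ := max (sphDecay lam u₁) 1 with hMχ
  have hMχ0 : 0 ≤ Mχ := le_trans zero_le_one (le_max_right _ _)
  have hχle : ∀ u ∈ Icc a b, sphDecay lam u ≤ Mχ := fun u hu =>
    le_trans ((isMaxOn_iff.mp hmax) u hu) (le_max_left _ _)
  refine ⟨Φb * Mχ, by positivity, fun t ht r hr => ?_⟩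
  have ht0 : 0 < t := lt_of_lt_of_le ha ht.1
  have hK : |sphGreenKernel lam t r| = sph lam (hyp (min t r)) * sphDecay lam (max t r) :=
    abs_sphGreenKernel_eq hlam ht0
  rw [hK]
  have hφ : sph lam (hyp (min t r)) ≤ Φb := hφle _ (le_min ht0.le hr.le) (le_trans (min_le_left _ _) ht.2)
  have hχ0 : 0 < sphDecay lam (max t r) := sphDecay_pos hlam (lt_max_of_lt_left ht0)
  rcases le_or_gt r b with hrb | hrb
  · -- `r ≤ b`: `max(t, r) ∈ [a, b]`
    have hmem : max t r ∈ Icc a b := ⟨le_trans ht.1 (le_max_left _ _), max_le ht.2 hrb⟩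
    have hind : Set.indicator (Ioc 0 b) (fun _ => (1 : ℝ)) r = 1 :=
      Set.indicator_of_mem (show r ∈ Ioc 0 b from ⟨hr, hrb⟩) _
    rw [hind]
    have hχpos : 0 ≤ sphDecay lam r := (sphDecay_pos hlam hr).le
    calc sph lam (hyp (min t r)) * sphDecay lam (max t r) ≤ Φb * Mχ :=
          mul_le_mul hφ (hχle _ hmem) hχ0.le hΦb0
      _ = Φb * Mχ * 1 := by ring
      _ ≤ Φb * Mχ * (1 + sphDecay lam r) := by
          apply mul_le_mul_of_nonneg_left _ (by positivity)
          linarith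
  · -- `r > b ≥ t`: `max(t, r) = r`
    have hmax' : max t r = r := max_eq_right (le_trans ht.2 hrb.le)
    have hind : Set.indicator (Ioc 0 b) (fun _ => (1 : ℝ)) r = 0 :=
      Set.indicator_of_notMem (fun h => absurd h.2 (not_le.mpr hrb)) _
    rw [hind, hmax', zero_add]
    have hM1 : 1 ≤ Mχ := le_max_right _ _
    calc sph lam (hyp (min t r)) * sphDecay lam r ≤ Φb * sphDecay lam r :=
          mul_le_mul_of_nonneg_right hφ (sphDecay_pos hlam hr).le
      _ = Φb * 1 * sphDecay lam r := by ring
      _ ≤ Φb * Mχ * sphDecay lam r := by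
          apply mul_le_mul_of_nonneg_right _ (sphDecay_pos hlam hr).le
          exact mul_le_mul_of_nonneg_left hM1 hΦb0

include hlam in
/-- The dominating function `(1_{(0,b]} + χ_λ) Ξ sinh 2r` is integrable on `(0, ∞)`. -/
theorem integrableOn_dominating (b : ℝ) :
    IntegrableOn (fun r => (Set.indicator (Ioc 0 b) (fun _ => (1 : ℝ)) r + sphDecay lam r)
      * sph 1 (hyp r) * Real.sinh (2 * r)) (Ioi 0) := by
  obtain ⟨hΞ, ⟨Φ, hΦ0, hΦ⟩, hεΞ, CΞ, hCΞ⟩ := sph_one_class hlam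
  have h2 : IntegrableOn (fun r => sphDecay lam r * sph 1 (hyp r) * Real.sinh (2 * r)) (Ioi 0) :=
    integrableOn_sphDecay_mul_mul_sinh hlam hΞ hΦ hΦ0 hεΞ (fun r hr => hCΞ r hr)
  have h1 : IntegrableOn (fun r => Set.indicator (Ioc 0 b) (fun _ => (1 : ℝ)) r * sph 1 (hyp r) * Real.sinh (2 * r))
      (Ioi 0) := by
    have hc : ContinuousOn (fun r => sph 1 (hyp r) * Real.sinh (2 * r)) (Icc 0 b) :=
      ((continuous_sph_hyp 1).mul (Real.continuous_sinh.comp (continuous_const.mul continuous_id))).continuousOn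
    have hI : IntegrableOn (fun r => sph 1 (hyp r) * Real.sinh (2 * r)) (Ioc 0 b) :=
      (hc.integrableOn_Icc).mono_set Set.Ioc_subset_Icc_self
    have e : (fun r => Set.indicator (Ioc 0 b) (fun _ => (1 : ℝ)) r * sph 1 (hyp r) * Real.sinh (2 * r))
        = Set.indicator (Ioc 0 b) (fun r => sph 1 (hyp r) * Real.sinh (2 * r)) := by
      funext r
      by_cases hr : r ∈ Ioc 0 b
      · rw [Set.indicator_of_mem hr, Set.indicator_of_mem hr]
        ring
      · rw [Set.indicator_of_notMem hr, Set.indicator_of_notMem hr]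
        ring
    rw [e]
    exact (hI.integrable_indicator measurableSet_Ioc).integrableOn
  have := h1.add h2
  refine this.congr_fun (fun r _ => ?_) measurableSet_Ioi
  simp only [Pi.add_apply]
  ring

include hlam in
/-- **THE COMPOSED KERNELS ARE CONTINUOUS ON `(0, ∞)²`**: `(t, s) ↦ K_λ^{∘(n+1)}(t, s)` is continuous on `(0, ∞)²` for every `n`. -/
theorem continuousOn_kernel_comp_prod (n : ℕ) :
    ContinuousOn (fun p : ℝ × ℝ => ((greenSolI (fun t => sph lam (hyp t)) (sphDecay lam))^[n]
      (fun r => sphGreenKernel lam r p.2)) p.1) (Ioi 0 ×ˢ Ioi 0) := by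
  induction n with
  | zero =>
    simpa only [Function.iterate_zero, id_eq] using continuousOn_sphGreenKernel_prod hlam
  | succ n ih =>
    intro p₀ hp₀
    obtain ⟨ht₀, hs₀⟩ := hp₀
    have ht₀' : (0 : ℝ) < p₀.1 := ht₀
    have hs₀' : (0 : ℝ) < p₀.2 := hs₀
    -- the box `[a, b]²` around `p₀`
    set a : ℝ := min p₀.1 p₀.2 / 2 with ha_def
    set b : ℝ := 2 * max p₀.1 p₀.2 with hb_def
    have ha : 0 < a := by
      rw [ha_def]
      exact half_pos (lt_min ht₀' hs₀')
    have hab : a ≤ b := by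
      rw [ha_def, hb_def]
      have h1 : min p₀.1 p₀.2 ≤ max p₀.1 p₀.2 := le_trans (min_le_left _ _) (le_max_left _ _)
      linarith [lt_min ht₀' hs₀']
    have hbox : Icc a b ×ˢ Icc a b ∈ 𝓝 p₀ := by
      apply prod_mem_nhds
      · apply Icc_mem_nhds
        · rw [ha_def]; linarith [min_le_left p₀.1 p₀.2]
        · rw [hb_def]; linarith [le_max_left p₀.1 p₀.2]
      · apply Icc_mem_nhds
        · rw [ha_def]; linarith [min_le_right p₀.1 p₀.2]
        · rw [hb_def]; linarith [le_max_right p₀.1 p₀.2]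
    -- the integral representation on the box and the dominating bound
    obtain ⟨M, hM0, hM⟩ := exists_abs_kernel_le_indicator_add hlam ha hab
    obtain ⟨C, hC, hC'⟩ := exists_kernel_comp_le_uniform hlam ha
    have hdom := integrableOn_dominating hlam b
    have hcont : ContinuousOn (fun p : ℝ × ℝ => ∫ r in Ioi 0, sphGreenKernel lam p.1 r
        * ((greenSolI (fun t => sph lam (hyp t)) (sphDecay lam))^[n] (fun r => sphGreenKernel lam r p.2)) r
        * Real.sinh (2 * r)) (Icc a b ×ˢ Icc a b) := by
      refine continuousOn_of_dominated (bound := fun r => M * (Set.indicator (Ioc 0 b) (fun _ => (1 : ℝ)) r + sphDecay lam r)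
        * (C * sph 1 (hyp r) / ((lam - 1) ^ 2) ^ n) * Real.sinh (2 * r)) ?_ ?_ ?_ ?_
      · -- measurability: continuity in `r`
        rintro ⟨t, s⟩ ⟨ht, hs⟩
        have ht0 : 0 < t := lt_of_lt_of_le ha ht.1
        have hs0 : 0 < s := lt_of_lt_of_le ha hs.1
        obtain ⟨D, _, hD⟩ := kernel_source_mem_weighted_one hlam hs0
        have hc := (iterate_mem_weighted_one hlam (kernel_source_continuousOn hlam hs0) hD n).1
        refine ContinuousOn.aestronglyMeasurable ?_ measurableSet_Ioi
        exact ((continuousOn_sphGreenKernel hlam ht0).mul hc).mul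
          (Real.continuous_sinh.comp (continuous_const.mul continuous_id)).continuousOn
      · -- the bound
        rintro ⟨t, s⟩ ⟨ht, hs⟩
        refine ae_restrict_of_forall_mem measurableSet_Ioi (fun r hr => ?_)
        have hr' : (0 : ℝ) < r := hr
        have hs0 : 0 < s := lt_of_lt_of_le ha hs.1
        rw [Real.norm_eq_abs, abs_mul, abs_mul, abs_of_pos (T5SU11ReductionOfOrder.sinh_two_mul_pos hr')]
        have h1 := hM t ht r hr'
        have h2 : |((greenSolI (fun t => sph lam (hyp t)) (sphDecay lam))^[n] (fun r => sphGreenKernel lam r s)) r|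
            ≤ C * sph 1 (hyp r) / ((lam - 1) ^ 2) ^ n := by
          have := hC' n r s hr' hs.1
          have hΞs : sph 1 (hyp s) ≤ 1 := sph_hyp_le_one zero_le_one one_le_two s
          have hr2 : 0 < ((lam - 1) ^ 2) ^ n := by
            have : 0 < lam - 1 := by linarith
            positivity
          calc _ ≤ C * sph 1 (hyp s) * sph 1 (hyp r) / ((lam - 1) ^ 2) ^ n := this
            _ ≤ C * 1 * sph 1 (hyp r) / ((lam - 1) ^ 2) ^ n := by
                apply div_le_div_of_nonneg_right _ hr2.le
                apply mul_le_mul_of_nonneg_right _ (sph_hyp_pos 1 r).le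
                exact mul_le_mul_of_nonneg_left hΞs hC.le
            _ = C * sph 1 (hyp r) / ((lam - 1) ^ 2) ^ n := by ring
        apply mul_le_mul_of_nonneg_right _ (T5SU11ReductionOfOrder.sinh_two_mul_pos hr').le
        exact mul_le_mul h1 h2 (abs_nonneg _)
          (mul_nonneg hM0 (add_nonneg (Set.indicator_nonneg (fun _ _ => zero_le_one) r) (sphDecay_pos hlam hr').le))
      · -- integrability of the bound
        have e : (fun r => M * (Set.indicator (Ioc 0 b) (fun _ => (1 : ℝ)) r + sphDecay lam r)
            * (C * sph 1 (hyp r) / ((lam - 1) ^ 2) ^ n) * Real.sinh (2 * r))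
            = fun r => (M * C / ((lam - 1) ^ 2) ^ n)
              * ((Set.indicator (Ioc 0 b) (fun _ => (1 : ℝ)) r + sphDecay lam r) * sph 1 (hyp r) * Real.sinh (2 * r)) := by
          funext r
          ring
        rw [e]
        exact hdom.const_mul _
      · -- continuity in the parameter for every `r > 0`
        refine ae_restrict_of_forall_mem measurableSet_Ioi (fun r hr => ?_)
        have hr' : (0 : ℝ) < r := hr
        have hsub : Icc a b ×ˢ Icc a b ⊆ Ioi 0 ×ˢ Ioi 0 := fun p hp =>
          ⟨lt_of_lt_of_le ha hp.1.1, lt_of_lt_of_le ha hp.2.1⟩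
        have h1 : ContinuousOn (fun p : ℝ × ℝ => sphGreenKernel lam p.1 r) (Icc a b ×ˢ Icc a b) := by
          have := (continuousOn_sphGreenKernel_prod hlam).comp
            (f := fun p : ℝ × ℝ => (p.1, r)) (continuous_fst.prodMk continuous_const).continuousOn
            (fun p (hp : p ∈ Icc a b ×ˢ Icc a b) => ⟨lt_of_lt_of_le ha hp.1.1, hr'⟩)
          exact this
        have h2 : ContinuousOn (fun p : ℝ × ℝ => ((greenSolI (fun t => sph lam (hyp t)) (sphDecay lam))^[n]
            (fun r => sphGreenKernel lam r p.2)) r) (Icc a b ×ˢ Icc a b) := by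
          have := ih.comp (f := fun p : ℝ × ℝ => (r, p.2)) (continuous_const.prodMk continuous_snd).continuousOn
            (fun p (hp : p ∈ Icc a b ×ˢ Icc a b) => ⟨hr', lt_of_lt_of_le ha hp.2.1⟩)
          exact this
        exact (h1.mul h2).mul continuousOn_const
    -- transfer to the composed kernel through the integral representation, then to `p₀`
    have hrep : ∀ p ∈ Icc a b ×ˢ Icc a b,
        ((greenSolI (fun t => sph lam (hyp t)) (sphDecay lam))^[n + 1] (fun r => sphGreenKernel lam r p.2)) p.1
          = ∫ r in Ioi 0, sphGreenKernel lam p.1 r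
            * ((greenSolI (fun t => sph lam (hyp t)) (sphDecay lam))^[n] (fun r => sphGreenKernel lam r p.2)) r
            * Real.sinh (2 * r) := by
      rintro ⟨t, s⟩ ⟨ht, hs⟩
      have ht0 : 0 < t := lt_of_lt_of_le ha ht.1
      have hs0 : 0 < s := lt_of_lt_of_le ha hs.1
      have h := kernel_comp_add hlam 0 n ht0 hs0
      simp only [zero_add, Function.iterate_zero, id_eq] at h
      exact h
    have hcont' : ContinuousOn (fun p : ℝ × ℝ => ((greenSolI (fun t => sph lam (hyp t)) (sphDecay lam))^[n + 1]
        (fun r => sphGreenKernel lam r p.2)) p.1) (Icc a b ×ˢ Icc a b) :=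
      hcont.congr hrep
    exact (hcont'.continuousAt hbox).continuousWithinAt

end measure

end Summit.Ventures.HodgeRepro2.T5SU11KernelCompositionContinuous
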